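import Summits.BirchSwinnertonDyer.Rank1Residual.X11b.AnticyclotomicCoinvariants
import Summits.BirchSwinnertonDyer.Rank1Residual.X11b.Three.ControlIdentityOdd
import Summits.BirchSwinnertonDyer.BirchSwinnertonDyer.Theorems.UniversalToricDescentNoFiniteSubmoduleOfRankOne
import Summits.BirchSwinnertonDyer.BirchSwinnertonDyer.Theorems.UniversalToricDescentStrictPlaceNoPTorsion
import HarnessLib

/-!
# Route UniversalToricDescent — the `Σ`-IMPRIMITIVE coinvariants vanish:
# `(conj_γ − 1)` is onto `Sel_𝔭^Σ(K_∞, E[p^∞])`, hence (N1) for `X_ac^Σ` and Greenberg–Vatsal's EXACT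
# `λ(X_ac^Σ(E)) = λ(X_ac^Σ(E′))` modulo the cited Poitou–Tate facts and base finiteness

Lead prover bsd-wall-utd-p1 g7 (`--supports stmt-BirchSwinnertonDyer-20399`; PRICING-20399-ALG-HALF §3(b)(c),
g6's open list «(N1) ×2 at `Σ`-level»). The tree's (L10) theorem
`X11b.Coinv.coinvariantsTrivialAt_of_subsingleton` (JSW17 Lemma 3.3.3 on the constructed objects:
procyclic descent from `H²(K, E[p^∞]) = 0`, local lifts, Poitou–Tate surgery) is stated for `Σ = ∅`. Its
proof imposes the away-conditions at ALL places `v ∤ p`; for the `Σ`-imprimitive group one needs them only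
OFF `Σ`, so the same construction works VERBATIM with the local lifts and prescriptions restricted to
`v ∉ Σ` (at `v ∈ Σ` nothing is asked of the corrected class). §1 is that adaptation —
`surjective_conjSelmerAc_sub_one_of_subsingleton` (adapted from
`Rank1Residual/X11b/AnticyclotomicCoinvariants.lean`, same hypotheses plus `Σ` finite-free: any `Σ`
of places prime to `p`). Consequences:

* §2 `forall_finite_eq_bot_sigma_of_noPTorsionPadic` — (N1) «no non-zero finite `Λ`-submodule» and
  `X[T] = 0` for `X_ac^Σ(E_K)` (`W/ℚ`, `K` imaginary quadratic with `p` split, degree-one strict place,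
  (iv) `E(ℚ_p)[p] = 0`, base finiteness at `v ∣ p`), GIVEN Poitou–Tate ×2 — via
  `UniversalToricDescentNoFiniteSubmodule.XAc.forall_finite_eq_bot_of_surjective`.
* §3 `lambdaInvariant_sigma_baseChange_eq_three` — **`λ(X_ac^Σ(E_K)) = λ(X_ac^Σ(E′_K))` at `p = 3`** in the
  binders of crux #2 / 21845 (strict place `𝔭′`, `Σ` finite ∌ primes above `3` containing the bad places
  of both curves), the twin's `X_ac^Σ` torsion with `μ = 0`, (iv), base finiteness for `E` AND `E′`,
  Poitou–Tate ×2: Greenberg–Vatsal's Thm. (1.4) algebraic λ-half at `Σ`-level with BOTH (N1) hypotheses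
  of g6's `lambdaInvariant_baseChange_eq_of_modPCongruent` discharged.

HONEST STATUS: helper theorems, CONDITIONAL on the cited `poitouTate_selmerStructure_duality K`,
`poitouTate_sha_tateDual K` (leaves 20461/20462); base finiteness for the twin is an input 21845 does not
carry; the passage `Σ → ∅` (local image = `Σ`-Euler factors: `loc_Σ` onto over `K_∞`) and the analytic half
remain. THEOREMS ONLY; no definition, no named fact, no `sorry`. BSD is not advanced by this file.
References: [JetchevSkinnerWan2017] Lemma 3.3.3, Prop. 3.3.2 (arXiv:1512.06894 pp. 11–12);
[GreenbergVatsal2000] Thm. (1.4), §2 Prop. (2.8); [GreenbergLNM1716] Prop. 4.14–4.15; [MilneADT2006] I 4.10.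
-/

set_option autoImplicit false
-- `…BirchSwinnertonDyer.BirchSwinnertonDyer.Theorems…` is the problem's mandated namespace (D-0017).
set_option linter.dupNamespace false

noncomputable section

open scoped Classical

namespace Summit.BirchSwinnertonDyer.BirchSwinnertonDyer.Theorems.UniversalToricDescentSigmaCoinvariants

open CategoryTheory Function Field NumberField IsDedekindDomain WeierstrassCurve
open Literature.NumberTheory.GaloisRepresentations Literature.NumberTheory.EllipticCurves
  Literature.NumberTheory.EllipticCurves.GreenbergSelmer Literature.NumberTheory.GaloisCohomology
  Literature.NumberTheory.EllipticCurves.IwasawaAlgebra Literature.NumberTheory.EllipticCurves.Rank1Residual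
  Summit.BirchSwinnertonDyer.Rank1Residual Summit.BirchSwinnertonDyer.Rank1Residual.X11b
  Summit.BirchSwinnertonDyer.Rank1Residual.X11b.Coinv Summit.BirchSwinnertonDyer.Rank1Residual.X11b.LocBridge
  Summit.BirchSwinnertonDyer.Rank1Residual.X11b.AcSelmer Summit.BirchSwinnertonDyer.Rank1Residual.X11b.H2Support
  Summit.BirchSwinnertonDyer.Rank1Residual.X11b.Levels Summit.BirchSwinnertonDyer.Rank1Residual.Iwasawa
  Summit.BirchSwinnertonDyer.BirchSwinnertonDyer.Theorems.UniversalToricDescentNoFiniteSubmodule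
  Summit.BirchSwinnertonDyer.BirchSwinnertonDyer.Theorems.UniversalToricDescentStrictPlace
  Summit.BirchSwinnertonDyer.BirchSwinnertonDyer.Theorems.UniversalToricDescentLambdaTransport
open Summit.BirchSwinnertonDyer.Rank1Residual.X11b.ProcyclicDescent (kerK)

/-! ### §1 JSW17 Lemma 3.3.3 for the `Σ`-imprimitive Selmer group (adapted from the tree's `Σ = ∅` proof) -/

section Sigma

variable {K : Type} [Field K] [NumberField K] (W : WeierstrassCurve K) [W.IsElliptic] (p : ℕ)
  [Fact p.Prime] (κ : ZpExtension K p)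

-- adapted from lean/Summits/BirchSwinnertonDyer/Rank1Residual/X11b/AnticyclotomicCoinvariants.lean
-- (`Coinv.coinvariantsTrivialAt_of_subsingleton`, cell b2b-bsdres): the away-conditions, local lifts and
-- local prescriptions are restricted to the places `v ∉ Σ`.
/-- **(L10) for `Sel_𝔭^Σ`: `conj_γ − 1` is ONTO `Sel_𝔭^Σ(K_∞, E[p^∞])`** for any set `Σ` of places prime
to `p`. Hypotheses as in the tree's `Σ = ∅` theorem: `K` totally complex; the cited Poitou–Tate fact for
`K` and Milne I 2.8 at the completions; `𝔭 ≠ 𝔮` above `p`; `E[p^∞]^{Γ_{K_𝔭}} = 0` ((iv)); `Sel_𝔮(K, E[p^∞])`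
finite; `H²(K, E[p^∞]) = 0`; `γ` a topological generator of `κ`. Proof: given `x ∈ Sel^Σ`, (1) `y₀` with
`conj_γ y₀ − y₀ = x` (procyclic descent from `H² = 0`); (2) `conj_g y₀ ≡ y₀ (mod Sel^Σ)` for all `g`;
(3) local lifts `Ψ_v` of `res_{K_∞,w} y₀` at the places `v ∉ Σ`, `v ∤ p`, and at `𝔭`, zero at the good
unramified ones; (4) Poitou–Tate surgery: a global `g` with `loc_v g = Ψ_v` on the finite exceptional set
off `Σ` and at `𝔭` (anything on `Σ`), locally trivial elsewhere; (5) `y = y₀ − res g ∈ Sel^Σ` and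
`conj_γ y − y = x`. [cite: JetchevSkinnerWan2017, Lemma 3.3.3 and Prop. 3.3.2 (arXiv:1512.06894 pp. 11–12)]
[cite: Castella2018, Def. 2.2 and Thm. 2.3 (arXiv:1704.06608 p. 5)] -/
theorem surjective_conjSelmerAc_sub_one_of_subsingleton [IsTotallyComplex K]
    (hPT : poitouTate_selmerStructure_duality K)
    (hEP : ∀ v : HeightOneSpectrum (𝓞 K), localEulerPoincareCharacteristic (v.adicCompletion K))
    {𝔭 𝔮 : HeightOneSpectrum (𝓞 K)} (h𝔭 : ((p : ℕ) : 𝓞 K) ∈ 𝔭.asIdeal)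
    (h𝔮 : ((p : ℕ) : 𝓞 K) ∈ 𝔮.asIdeal) (hne : 𝔮 ≠ 𝔭)
    (hΓ𝔭 : ∀ Q : W.geomPrimaryTorsion p,
      (∀ σ : absoluteGaloisGroup (𝔭.adicCompletion K),
        GaloisRep.restrictField (𝔭.adicCompletion K) (primaryGaloisModule W p) σ Q = Q) → Q = 0)
    (hfin : Finite (selmerAcBase W p 𝔮 ∅))
    (h2 : Subsingleton (galoisCohomology (primaryGaloisModule W p) 2))
    {γ : absoluteGaloisGroup K} (hγ : κ.IsTopGenerator γ) (S : Set (HeightOneSpectrum (𝓞 K))) :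
    Function.Surjective
      ((conjSelmerAc W p κ 𝔭 S γ - 1 : AddMonoid.End (selmerAc W p κ 𝔭 S)) :
        selmerAc W p κ 𝔭 S → selmerAc W p κ 𝔭 S) := by
  intro x
  have hM : ∀ m : W.geomPrimaryTorsion p, IsOpen {σ : absoluteGaloisGroup K | σ • m = m} :=
    isOpen_stabilizer_geomPrimaryTorsion W p
  have hΓ := noInvariants_of_noInvariants_at W p hΓ𝔭
  -- (1) `y₀` with `conj_γ y₀ - y₀ = x`
  obtain ⟨y₀, hy₀⟩ :=
    exists_conjH1_sub_eq_of_subsingleton W p κ h2 hγ (x : W.subgroupH1 p κ.kerSubgroup)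
  -- (2) all conjugates of `y₀` agree with `y₀` modulo `Sel^Σ`
  have hSel : ∀ g : absoluteGaloisGroup K,
      W.conjH1 p κ.kerSubgroup g y₀ - y₀ ∈ selmerAc W p κ 𝔭 S :=
    conjH1_sub_mem_selmerAc_of_isTopGenerator hγ (by rw [hy₀]; exact x.2)
  -- the cocycle of `y₀` and its zero set
  obtain ⟨φ, hφ⟩ := oneCocycleClass_surjective _ y₀
  obtain ⟨N₁, hN₁⟩ := exists_openNormalSubgroup_forall_apply_eq_zero (K := K) φ
  -- the exceptional set `Σ'` (finite, away from `p`)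
  set S' : Set (HeightOneSpectrum (𝓞 K)) := {v | ((p : ℕ) : 𝓞 K) ∉ v.asIdeal ∧
    (¬ W.HasGoodReductionAt v ∨
      ¬ (adicCompletionPrime K v).inertia (absoluteGaloisGroup K) ≤ (N₁ : Subgroup _))} with hS'
  have hS'fin : S'.Finite := finite_exceptional W p N₁
  have hSp : ∀ v ∈ S', ((p : ℕ) : 𝓞 K) ∉ v.asIdeal := fun v hv ↦ hv.1
  -- (3) the local lifts, at the places OFF `Σ` (and at `𝔭`)
  have hz : ∀ v : HeightOneSpectrum (𝓞 K), ((((p : ℕ) : 𝓞 K) ∉ v.asIdeal ∧ v ∉ S) ∨ v = 𝔭) →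
      ∃ z : subgroupH1 (decomp (K := K) v) (W.geomPrimaryTorsion p),
        ResKernel.resSubgroup (kerD κ v) (W.geomPrimaryTorsion p) z =
          resKerD κ (W.geomPrimaryTorsion p) v y₀ := fun v hv ↦
    exists_resSubgroup_kerD_eq v hv hSel
  choose z hz using hz
  -- at the good unramified `v ∉ Σ' ∪ Σ`, `v ∤ p`: `Ψ_v = 0` and `y₀` is locally trivial
  have hzero : ∀ (v : HeightOneSpectrum (𝓞 K)) (hpv : ((p : ℕ) : 𝓞 K) ∉ v.asIdeal) (hvS0 : v ∉ S),
      v ∉ S' → resKerD κ (W.geomPrimaryTorsion p) v y₀ = 0 := by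
    intro v hpv hvS0 hvS
    have hgood : W.HasGoodReductionAt v := by
      by_contra h; exact hvS ⟨hpv, Or.inl h⟩
    have hI : (adicCompletionPrime K v).inertia (absoluteGaloisGroup K) ≤ (N₁ : Subgroup _) := by
      by_contra h; exact hvS ⟨hpv, Or.inr h⟩
    have h := hz v (Or.inl ⟨hpv, hvS0⟩)
    rw [← hφ] at h ⊢
    exact (eq_zero_of_inertia_le hpv hgood φ hN₁ hI (z v (Or.inl ⟨hpv, hvS0⟩)) h).2
  -- the finite set `T` of places: `∞ ∪ {v ∣ p} ∪ Σ'`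
  have hp0 : p ≠ 0 := (Fact.out : p.Prime).ne_zero
  set T : Finset (Place K) := (Finset.univ.image Sum.inl) ∪
    (((finite_setOf_natCast_mem (K := K) p hp0).toFinset ∪ hS'fin.toFinset).image Sum.inr) with hT
  have hinf : ∀ w : InfinitePlace K, (Sum.inl w : Place K) ∈ T := fun w ↦
    Finset.mem_union_left _ (Finset.mem_image_of_mem _ (Finset.mem_univ w))
  have hpT : ∀ v : HeightOneSpectrum (𝓞 K), ((p : ℕ) : 𝓞 K) ∈ v.asIdeal →
      (Sum.inr v : Place K) ∈ T := fun v hv ↦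
    Finset.mem_union_right _ (Finset.mem_image_of_mem _
      (Finset.mem_union_left _ ((Set.Finite.mem_toFinset _).mpr hv)))
  have hSig : ∀ v ∈ S', (Sum.inr v : Place K) ∈ T := fun v hv ↦
    Finset.mem_union_right _ (Finset.mem_image_of_mem _
      (Finset.mem_union_right _ ((Set.Finite.mem_toFinset _).mpr hv)))
  have hbad : ∀ v : HeightOneSpectrum (𝓞 K), ¬ W.HasGoodReductionAt v →
      (Sum.inr v : Place K) ∈ T := by
    intro v hv
    by_cases hpv : ((p : ℕ) : 𝓞 K) ∈ v.asIdeal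
    · exact hpT v hpv
    · exact hSig v ⟨hpv, Or.inl hv⟩
  have hRfin : {v : HeightOneSpectrum (𝓞 K) | (Sum.inr v : Place K) ∈ T ∧
      ((p : ℕ) : 𝓞 K) ∉ v.asIdeal}.Finite :=
    (T.finite_toSet.preimage Sum.inr_injective.injOn).subset fun v hv ↦ hv.1
  have hfinR := finite_relaxed W p (𝔮 := 𝔮) hEP hfin hRfin (fun v hv ↦ hv.2)
  -- the family of local classes on `Σ'⁺ = Σ' ∪ {𝔭}` (zero at the places of `Σ`) and a killing exponent
  let τ : ∀ v : (insert 𝔭 S' : Set (HeightOneSpectrum (𝓞 K))),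
      galoisCohomology
        ((primaryGaloisModule W p).toLocal (Sum.inr (v : HeightOneSpectrum (𝓞 K)))) 1 :=
    fun v ↦
      if h : ((((p : ℕ) : 𝓞 K) ∉ (v : HeightOneSpectrum (𝓞 K)).asIdeal ∧
          (v : HeightOneSpectrum (𝓞 K)) ∉ S) ∨ (v : HeightOneSpectrum (𝓞 K)) = 𝔭) then
        inflDecomp hM (v : HeightOneSpectrum (𝓞 K)) (z v h)
      else 0
  obtain ⟨K₀, hK₀⟩ := exists_pow_nsmul_family_eq_zero (hS'fin.insert 𝔭) τ
  -- (4) Poitou–Tate surgery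
  obtain ⟨N, xN, hxN, hloc⟩ := levelLiftingP_of_finite W p 𝔭 S' T hPT
    (fun w ↦ IsTotallyComplex.isComplex w) hΓ hΓ𝔭 h𝔭 h𝔮 hne hSp hinf hpT hSig hbad hfinR K₀ τ hK₀
  set g : galoisCohomology (primaryGaloisModule W p) 1 :=
    galoisCohomology.map (Levels.primaryInclusion W p N) 1 xN with hg
  -- (5) the corrected class
  set y : W.subgroupH1 p κ.kerSubgroup :=
    y₀ - ResKernel.resSubgroup κ.kerSubgroup (W.geomPrimaryTorsion p) (toDiscreteH1 hM g) with hy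
  have hconj : ∀ σ : absoluteGaloisGroup K, W.conjH1 p κ.kerSubgroup σ y =
      y + (W.conjH1 p κ.kerSubgroup σ y₀ - y₀) := by
    intro σ
    rw [hy, map_sub, conjH1_resSubgroup]
    abel
  -- the local computation of `y`
  have hresy : ∀ (v : HeightOneSpectrum (𝓞 K)), resKerD κ (W.geomPrimaryTorsion p) v y =
      resKerD κ (W.geomPrimaryTorsion p) v y₀ -
        ResKernel.resSubgroup (kerD κ v) (W.geomPrimaryTorsion p)
          (ResKernel.resSubgroup (decomp v) (W.geomPrimaryTorsion p) (toDiscreteH1 hM g)) := by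
    intro v
    rw [hy, map_sub, resKerD_resSubgroup]
  have haway : ∀ (v : HeightOneSpectrum (𝓞 K))
      (hv : (((p : ℕ) : 𝓞 K) ∉ v.asIdeal ∧ v ∉ S) ∨ v = 𝔭),
      y ∈ awayKer κ.kerSubgroup (W.geomPrimaryTorsion p) v := by
    intro v hv
    rw [mem_awayKer_iff_resKerD_eq_zero, hresy]
    by_cases hvI : v ∈ insert 𝔭 S'
    · -- prescribed place: `loc_v g = infl Ψ_v`
      have hl := hloc ⟨v, hvI⟩
      have hτ : τ ⟨v, hvI⟩ = inflDecomp hM v (z v hv) := dif_pos hv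
      rw [hτ] at hl
      have e : ResKernel.resSubgroup (decomp v) (W.geomPrimaryTorsion p) (toDiscreteH1 hM g) =
          z v hv :=
        resSubgroup_decomp_eq_of_localization_eq hM v g _ hl
      rw [e, hz, sub_self]
    · -- other place away from `p`: `loc_v g = 0` and `y₀` locally trivial
      have hpvS0 : ((p : ℕ) : 𝓞 K) ∉ v.asIdeal ∧ v ∉ S := by
        rcases hv with h | rfl
        · exact h
        · exact (hvI (Set.mem_insert _ _)).elim
      have hvS : v ∉ S' := fun h ↦ hvI (Set.mem_insert_of_mem _ h)
      have h0 : galoisCohomology.localization (primaryGaloisModule W p) (Sum.inr v) 1 g = 0 :=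
        localization_map_primaryInclusion_eq_zero_of_mem_upperStructureP W p N 𝔭 S' hxN h𝔭 hpvS0.1
          hvS
      rw [resSubgroup_decomp_eq_zero_of_localization_eq_zero hM v g h0, map_zero, sub_zero]
      exact hzero v hpvS0.1 hpvS0.2 hvS
  have hySel : y ∈ selmerAc W p κ 𝔭 S := by
    change y ∈ selmerOver κ.kerSubgroup (W.geomPrimaryTorsion p) p 𝔭 S
    rw [mem_selmerOver_iff_awayKer]
    refine ⟨fun v hpv hvS0 σ ↦ ?_, fun w σ ↦ ?_, fun σ ↦ ?_⟩
    · rw [hconj]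
      exact add_mem (haway v (Or.inl ⟨hpv, hvS0⟩)) ((mem_awayKer_iff_resKerD_eq_zero κ v _).2
        (resKerD_eq_zero_of_mem_selmerAc (Or.inl ⟨hpv, hvS0⟩) (hSel σ)))
    · exact mem_infKer_of_decompInf_eq_bot w
        (decompInf_eq_bot_of_isComplex (IsTotallyComplex.isComplex w)) _
    · rw [hconj]
      exact add_mem (haway 𝔭 (Or.inr rfl)) ((mem_awayKer_iff_resKerD_eq_zero κ 𝔭 _).2
        (resKerD_eq_zero_of_mem_selmerAc (Or.inr rfl) (hSel σ)))
  refine ⟨⟨y, hySel⟩, Subtype.ext ?_⟩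
  change W.conjH1 p κ.kerSubgroup γ y - y = (x : W.subgroupH1 p κ.kerSubgroup)
  rw [hconj, hy₀]
  abel

end Sigma

/-! ### §2 (N1) and `X[T] = 0` for `X_ac^Σ(E_K)` from (iv) and the cited facts -/

section Route

variable (W : WeierstrassCurve ℚ) [W.IsElliptic] [W.IsGloballyMinimal] (p : ℕ) [Fact p.Prime]
  {K : Type} [Field K] [NumberField K]

/-- **(L10) for `Sel_𝔭^Σ` at an additive datum.** For `K` imaginary quadratic with `p` split, (iv)
`E(ℚ_p)[p] = 0`, a `ℤ_p`-extension `κ` with topological generator `γ`, a degree-one `𝔭 ∋ p`, ANY `Σ`,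
and `Sel_v(K, E[p^∞])` finite at every `v ∣ p`: `conj_γ − 1` is onto `Sel_𝔭^Σ(K_∞, E[p^∞])`, GIVEN
Poitou–Tate ×2 (weak Leopoldt `H²(K, E[p^∞]) = 0` from the tree's
`WeakLeopoldt.subsingleton_galoisCohomology_two_primary`, then §1). The tree's
`X11b.coinvariantsTrivialAt_of_noPTorsion` is the case `Σ = ∅`.
[cite: JetchevSkinnerWan2017, Lemma 3.3.3 (arXiv:1512.06894 pp. 11–12)] [cite: MilneADT2006, Ch. I, Thm. 4.10 and Thm. 2.8] -/
theorem surjective_conjSelmerAc_sub_one_of_noPTorsionPadic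
    (h4 : ∀ R : (W.baseChange ℚ_[p]).toAffine.Point, p • R = 0 → R = 0)
    (hPT : poitouTate_selmerStructure_duality K) (hPT2 : poitouTate_sha_tateDual K)
    (hK : IsImaginaryQuadratic K) (hsplit : SplitsIn K p)
    (κ : ZpExtension K p) {γ : absoluteGaloisGroup K} (hγ : κ.IsTopGenerator γ)
    {𝔭 : HeightOneSpectrum (𝓞 K)} (h𝔭 : ((p : ℕ) : 𝓞 K) ∈ 𝔭.asIdeal)
    (he : 𝔭.asIdeal.ramificationIdx (𝓞 ℚ) = 1) (hf : 𝔭.asIdeal.inertiaDeg (𝓞 ℚ) = 1)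
    (hfin : ∀ v : HeightOneSpectrum (𝓞 K), ((p : ℕ) : 𝓞 K) ∈ v.asIdeal →
      Finite (selmerAcBase (W.baseChange K) p v ∅))
    (S : Set (HeightOneSpectrum (𝓞 K))) :
    Function.Surjective
      ((conjSelmerAc (W.baseChange K) p κ 𝔭 S γ - 1 : AddMonoid.End (selmerAc (W.baseChange K) p κ 𝔭 S)) :
        selmerAc (W.baseChange K) p κ 𝔭 S → selmerAc (W.baseChange K) p κ 𝔭 S) := by
  haveI : IsTotallyComplex K := hK.2
  obtain ⟨σ, 𝔮, -, hne, h𝔮, -⟩ :=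
    LocalIndexTransport.exists_conj_prime_of_splitsIn K p hK.1 hsplit h𝔭
  have hΓ𝔭 := noInvariantsAt_of_noPTorsion W p h4 K κ 𝔭 h𝔭 he hf
  have hΓ := Coinv.noInvariants_of_noInvariants_at (W.baseChange K) p hΓ𝔭
  have htor := exists_pow_nsmul_local_eq_zero W p hK.1 hsplit
  haveI := hfin 𝔭 h𝔭
  have h2 := WeakLeopoldt.subsingleton_galoisCohomology_two_primary (W.baseChange K) p 𝔭 ∅ hPT2
    (fieldCdLE_two_of_isTotallyComplex fieldCdLE_two_of_numberField_holds K p) hΓ htor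
  exact surjective_conjSelmerAc_sub_one_of_subsingleton (W.baseChange K) p κ hPT
    (fun v ↦ GaloisImage.EP.localEulerPoincareCharacteristic_adicCompletion K v) h𝔭 h𝔮 hne hΓ𝔭
    (hfin 𝔮 h𝔮) h2 hγ S

/-- **(N1) and `X[T] = 0` for the `Σ`-imprimitive dual `X_ac^Σ(E_K)`**, same hypotheses: no non-zero
finite `Λ`-submodule and trivial `Γ`-invariants (§1 + `XAc.forall_finite_eq_bot_of_surjective`).
[cite: GreenbergLNM1716, Prop. 4.14–4.15 (pp. 124–126)] [cite: JetchevSkinnerWan2017, Lemma 3.3.3 (arXiv:1512.06894 pp. 11–12)] -/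
theorem forall_finite_eq_bot_sigma_of_noPTorsionPadic
    (h4 : ∀ R : (W.baseChange ℚ_[p]).toAffine.Point, p • R = 0 → R = 0)
    (hPT : poitouTate_selmerStructure_duality K) (hPT2 : poitouTate_sha_tateDual K)
    (hK : IsImaginaryQuadratic K) (hsplit : SplitsIn K p)
    (κ : ZpExtension K p) (γ : absoluteGaloisGroup K) [hγ : Fact (κ.IsTopGenerator γ)]
    {𝔭 : HeightOneSpectrum (𝓞 K)} (h𝔭 : ((p : ℕ) : 𝓞 K) ∈ 𝔭.asIdeal)
    (he : 𝔭.asIdeal.ramificationIdx (𝓞 ℚ) = 1) (hf : 𝔭.asIdeal.inertiaDeg (𝓞 ℚ) = 1)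
    (hfin : ∀ v : HeightOneSpectrum (𝓞 K), ((p : ℕ) : 𝓞 K) ∈ v.asIdeal →
      Finite (selmerAcBase (W.baseChange K) p v ∅))
    (S : Set (HeightOneSpectrum (𝓞 K))) :
    (∀ N : Submodule (IwasawaAlgebra p) (XAc (W.baseChange K) p κ 𝔭 S γ), Finite N → N = ⊥) ∧
      invariants p (XAc (W.baseChange K) p κ 𝔭 S γ) = ⊥ :=
  have hs := surjective_conjSelmerAc_sub_one_of_noPTorsionPadic W p h4 hPT hPT2 hK hsplit κ hγ.out h𝔭
    he hf hfin S
  ⟨XAc.forall_finite_eq_bot_of_surjective (W.baseChange K) p κ 𝔭 S γ hs,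
    XAc.invariants_eq_bot_of_surjective (W.baseChange K) p κ 𝔭 S γ hs⟩

/-- **(N1) for `X_ac^Σ(E_K)` at a rank-one datum** (base finiteness from O5's exact count, as in
`forall_finite_eq_bot_baseChange_of_rankOne`). [cite: JetchevSkinnerWan2017, Prop. 3.2.1 and Lemma 3.3.3 (arXiv:1512.06894 pp. 10–12)]
[cite: GreenbergLNM1716, Prop. 4.14–4.15 (pp. 124–126)] -/
theorem forall_finite_eq_bot_sigma_of_rankOne
    (h4 : ∀ R : (W.baseChange ℚ_[p]).toAffine.Point, p • R = 0 → R = 0)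
    (hPT : poitouTate_selmerStructure_duality K) (hPT2 : poitouTate_sha_tateDual K)
    (hK : IsImaginaryQuadratic K) (hsplit : SplitsIn K p)
    (hrank : (W.baseChange K).mordellWeilRank = 1) (hSha : (W.baseChange K).ShaFinite)
    (P : (W.baseChange K).toAffine.Point) (hP : ¬ IsOfFinAddOrder P)
    (κ : ZpExtension K p) (γ : absoluteGaloisGroup K) [Fact (κ.IsTopGenerator γ)]
    {𝔭 : HeightOneSpectrum (𝓞 K)} (h𝔭 : ((p : ℕ) : 𝓞 K) ∈ 𝔭.asIdeal)
    (S : Set (HeightOneSpectrum (𝓞 K))) :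
    ∀ N : Submodule (IwasawaAlgebra p) (XAc (W.baseChange K) p κ 𝔭 S γ), Finite N → N = ⊥ := by
  obtain ⟨he, hf⟩ := degreeOne_of_splitsIn hK.1 hsplit h𝔭
  exact (forall_finite_eq_bot_sigma_of_noPTorsionPadic W p h4 hPT hPT2 hK hsplit κ γ h𝔭 he hf
    (finite_selmerAcBase_of_rankOne W p h4 hK hsplit hPT hrank hSha P hP) S).1

end Route

/-! ### §3 Greenberg–Vatsal's exact `λ(X_ac^Σ(E)) = λ(X_ac^Σ(E′))` at `p = 3`, (N1) discharged on both sides -/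

section Three

/-- **`λ(X_ac^Σ(E_K)) = λ(X_ac^Σ(E′_K))` (and torsion, `μ = 0` for `E`) in the binders of crux #2 /
21845**, with BOTH «no finite `Λ`-submodule» hypotheses of g6's transport DISCHARGED: `E/ℚ` wild at `3`
(`ClassO6 W 3`), `N = N(E)`, a mod-`3` twin `E′` (`ModPCongruent W′ W 3`), `K` imaginary quadratic
Heegner for `N` (so `3` splits), ANY `ℤ₃`-extension `κ` with topological generator `γ`, `𝔭′ ∋ 3` the
strict place, a finite `Σ ∌ (v ∣ 3)` containing the bad places of `E_K`, `E′_K` prime to `3`, (iv)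
`E(ℚ₃)[3] = 0`, base finiteness `Sel_v(K, ·) < ∞` at `v ∣ 3` for `E` AND `E′`, the twin's `X_ac^Σ(E′_K)`
torsion with `μ = 0` — GIVEN the two cited Poitou–Tate facts. This is Greenberg–Vatsal's Thm. (1.4)
(algebraic λ-half) at the `Σ`-imprimitive level for Castella's anticyclotomic Selmer groups at the wild
prime. [cite: GreenbergVatsal2000, Thm. (1.4) and §2 Prop. (2.8) (pp. 26–27)]
[cite: JetchevSkinnerWan2017, Lemma 3.3.3 (arXiv:1512.06894 pp. 11–12)] [cite: MilneADT2006, Ch. I, Thm. 4.10] -/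
theorem lambdaInvariant_sigma_baseChange_eq_three (W W' : WeierstrassCurve ℚ) [W.IsElliptic]
    [W.IsGloballyMinimal] [W'.IsElliptic] [W'.IsGloballyMinimal] {N : ℕ} (K : Type) [Field K]
    [NumberField K] (hO6 : Additive.ClassO6 W 3) (hN : W.conductorNorm ℤ = N)
    (hcong : O6.ModPCongruent W' W 3) (hK : IsImaginaryQuadratic K)
    (hHe : SatisfiesHeegnerHypothesis N K) (κ : ZpExtension K 3) (γ : absoluteGaloisGroup K)
    [Fact (κ.IsTopGenerator γ)] {𝔭' : HeightOneSpectrum (𝓞 K)} (h𝔭' : ((3 : ℕ) : 𝓞 K) ∈ 𝔭'.asIdeal)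
    {S : Set (HeightOneSpectrum (𝓞 K))} (hS : S.Finite)
    (hSW : ∀ v : HeightOneSpectrum (𝓞 K), v ∉ S → ((3 : ℕ) : 𝓞 K) ∉ v.asIdeal →
      (W.baseChange K).HasGoodReductionAt v)
    (hSW' : ∀ v : HeightOneSpectrum (𝓞 K), v ∉ S → ((3 : ℕ) : 𝓞 K) ∉ v.asIdeal →
      (W'.baseChange K).HasGoodReductionAt v)
    (h4 : ∀ R : (W.baseChange ℚ_[3]).toAffine.Point, 3 • R = 0 → R = 0)
    (hPT : poitouTate_selmerStructure_duality K) (hPT2 : poitouTate_sha_tateDual K)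
    (hfin : ∀ v : HeightOneSpectrum (𝓞 K), ((3 : ℕ) : 𝓞 K) ∈ v.asIdeal →
      Finite (selmerAcBase (W.baseChange K) 3 v ∅))
    (hfin' : ∀ v : HeightOneSpectrum (𝓞 K), ((3 : ℕ) : 𝓞 K) ∈ v.asIdeal →
      Finite (selmerAcBase (W'.baseChange K) 3 v ∅))
    (hT' : Module.IsTorsion (IwasawaAlgebra 3) (XAc (W'.baseChange K) 3 κ 𝔭' S γ))
    (hμ' : muInvariant 3 (XAc (W'.baseChange K) 3 κ 𝔭' S γ) = 0) :
    Module.IsTorsion (IwasawaAlgebra 3) (XAc (W.baseChange K) 3 κ 𝔭' S γ) ∧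
      muInvariant 3 (XAc (W.baseChange K) 3 κ 𝔭' S γ) = 0 ∧
      lambdaInvariant 3 (XAc (W.baseChange K) 3 κ 𝔭' S γ) =
        lambdaInvariant 3 (XAc (W'.baseChange K) 3 κ 𝔭' S γ) := by
  haveI : Fact (Nat.Prime 3) := ⟨Nat.prime_three⟩
  have hadd : Addv W 3 := hO6.2.1
  have hpN : 3 ∣ W.conductorNorm ℤ :=
    (W.dvd_conductorNorm_iff_not_hasGoodReductionAtPrime 3).mpr hadd.1
  have hsplit : SplitsIn K 3 := hHe 3 (Fact.out) (hN ▸ hpN)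
  obtain ⟨he', hf'⟩ := degreeOne_of_splitsIn hK.1 hsplit h𝔭'
  have h4' : ∀ R : (W'.baseChange ℚ_[3]).toAffine.Point, 3 • R = 0 → R = 0 :=
    (UniversalToricDescentTowerTorsion.baseChange_noPTorsion_iff_of_modPCongruent 3 W W' ℚ_[3] hcong).mp
      h4
  have hnf := (forall_finite_eq_bot_sigma_of_noPTorsionPadic W 3 h4 hPT hPT2 hK hsplit κ γ h𝔭' he' hf'
    hfin S).1
  have hnf' := (forall_finite_eq_bot_sigma_of_noPTorsionPadic W' 3 h4' hPT hPT2 hK hsplit κ γ h𝔭' he'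
    hf' hfin' S).1
  exact lambdaInvariant_baseChange_eq_of_modPCongruent_of_noPTorsionPadic W W' K κ γ (by decide) h𝔭'
    he' hf' hS hSW hSW' hcong h4 hT' hμ' hnf' hnf

end Three

end Summit.BirchSwinnertonDyer.BirchSwinnertonDyer.Theorems.UniversalToricDescentSigmaCoinvariants

end
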